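import Mathlib
import Literature.AlgebraicGeometry.Resolution.PolygonChartTransport
import HarnessLib

/-!
# The non-rational chart of a point blow-up: setup, containment transport, `φ′`-adic factorisation

Topic: `Literature/AlgebraicGeometry/Resolution`. At a closed point `x′` of the exceptional
divisor of the blowing up of `x` which is NOT rational over `x` and lies in the `u₁`-chart,
Cossart–Piltant (2008, proof of Lemma 4.5, pp. 12–13) and Cossart–Jannsen–Saito (LNM 2270,
Ch. 14, Lemma 14.1) use the regular system of parameters

  `(y′ = y/u₁, u₁, φ′ = P(1, u₂/u₁))`,  `k(x′) ≅ k(x)[U₂]/(P(1, U₂))`, `d = deg P = [k(x′) : k(x)] ≥ 2`.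

Abstract setting: a ring map `φ : R → R′` of regular local rings of dimension `3`, `c = (y, u₁, u₂)`,
`c′ = (y′, u₁, φ′)` with `c′₁ = φ u₁`, `φ y = φ u₁ · y′`, `φ u₂ = φ u₁ · t` for a unit `t ∈ R′`
(the class of `u₂/u₁`), `c′₂ = P(t)` for a polynomial `P ∈ R[T]` whose reduction `P̄ ∈ k[T]`
governs the residue field: `G(t) ∈ 𝔪′ ⟺ P̄ ∣ Ḡ`. PROVED (no facts):

* `nrPullbackWeight W′ = (W′₀ + W′₁, W′₁, W′₁)`, `map_weightedIdealW_le_nr`,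
  `colon_le_weightedIdealW_of_le_nr` — **containments descend** (the `u₂`-direction is lost:
  `t` is a unit), whence the lower bound `α′ ≥ δ − 1` (CJS (14.10); CoP1 (21)):
  `deltaS_le_spt₁_nr_add`;
* `exists_pow_mul_unit_add` — **`φ′`-adic factorisation**: for `G ∈ R[T]` with some unit
  coefficient, `G(t) = φ′^s · v + u₁ · r` with `v` a unit and `s · deg P̄ ≤ deg Ḡ`
  (CJS (14.4)/(14.9): `P_{i,B} = Φ^{e_i(B)} Q_{i,B}`, `q′ ∈ R′^× ⟺ Q ≢ 0`).

## Sources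

* V. Cossart, O. Piltant, J. Algebra 320 (2008), proof of Lemma 4.5, pp. 12–13, (20)–(22).
  [CossartPiltant2008]
* V. Cossart, U. Jannsen, S. Saito, LNM 2270 (2020), Ch. 14, Lemma 14.1, (14.3)–(14.10).
  [CossartJannsenSaito2020]
-/

noncomputable section

open IsLocalRing MvPolynomial

namespace Literature.AlgebraicGeometry.Resolution

universe u

section NonRational

variable {R R' : Type u} [CommRing R] [CommRing R'] (φ : R →+* R') {c : Fin 3 → R}
  {c' : Fin 3 → R'} (h₁ : c' 1 = φ (c 1)) (h₀ : φ (c 0) = φ (c 1) * c' 0) {t : R'}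
  (ht : φ (c 2) = φ (c 1) * t) (W' : Fin 3 → ℕ)

/-- The pulled-back weight `(W′₀ + W′₁, W′₁, W′₁)` of the non-rational chart (`u₂ = u₁ t` with `t`
a unit carries only the weight of `u₁`). [cite: CossartJannsenSaito2020, Lemma 14.1] -/
def nrPullbackWeight (W' : Fin 3 → ℕ) : Fin 3 → ℕ := ![W' 0 + W' 1, W' 1, W' 1]

/-- The weight of an exponent for the non-rational pull-back. [folklore] -/
theorem weight_nrPullbackWeight (e : Fin 3 →₀ ℕ) :
    Finsupp.weight (nrPullbackWeight W') e = W' 0 * e 0 + W' 1 * (e 0 + e 1 + e 2) := by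
  rw [Finsupp.weight_apply, Finsupp.sum_fintype _ _ (by simp)]
  simp only [Fin.sum_univ_three, nrPullbackWeight, Matrix.cons_val_zero, Matrix.cons_val_one,
    Matrix.cons_val_two, Matrix.tail_cons, Matrix.head_cons, smul_eq_mul]
  ring

/-- The exponent `(e₀, |e|, 0)` of the monomial part of `φ(c^e)` in the non-rational chart. [folklore] -/
def nrExp (e : Fin 3 →₀ ℕ) : Fin 3 →₀ ℕ := Finsupp.equivFunOnFinite.symm ![e 0, e 0 + e 1 + e 2, 0]

/-- Component. [folklore] -/
@[simp] theorem nrExp_apply_zero (e : Fin 3 →₀ ℕ) : nrExp e 0 = e 0 := rfl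
/-- Component. [folklore] -/
@[simp] theorem nrExp_apply_one (e : Fin 3 →₀ ℕ) : nrExp e 1 = e 0 + e 1 + e 2 := rfl
/-- Component. [folklore] -/
@[simp] theorem nrExp_apply_two (e : Fin 3 →₀ ℕ) : nrExp e 2 = 0 := rfl

/-- The weight of `nrExp e` is the non-rational pull-back weight of `e`. [folklore] -/
theorem weight_nrExp (e : Fin 3 →₀ ℕ) :
    Finsupp.weight W' (nrExp e) = Finsupp.weight (nrPullbackWeight W') e := by
  rw [weight_nrPullbackWeight, Finsupp.weight_apply, Finsupp.sum_fintype _ _ (by simp)]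
  simp only [Fin.sum_univ_three, nrExp_apply_zero, nrExp_apply_one, nrExp_apply_two, smul_eq_mul]
  ring

include h₁ h₀ ht in
/-- The non-rational chart on monomials: `φ(c^e) = c′₀^{e₀} (φ u₁)^{|e|} · t^{e₂}`. [cite: CossartPiltant2008, (20)] -/
theorem map_monom3_nr (e : Fin 3 →₀ ℕ) : φ (monom3 c e) = monom3 c' (nrExp e) * t ^ e 2 := by
  simp only [monom3, map_mul, map_pow, h₀, ht, nrExp_apply_zero, nrExp_apply_one, nrExp_apply_two,
    pow_zero, mul_one, h₁]
  ring

include h₁ h₀ ht in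
/-- `φ(F^{(W)}_ρ) ⊆ F′^{(W′)}_ρ` for the non-rational pull-back `W`. [cite: CossartJannsenSaito2020, (14.8)] -/
theorem map_weightedIdealW_le_nr (ρ : ℕ) :
    (weightedIdealW c (nrPullbackWeight W') ρ).map φ ≤ weightedIdealW c' W' ρ := by
  rw [weightedIdealW, Ideal.map_span, Ideal.span_le]
  rintro _ ⟨_, ⟨e, he, rfl⟩, rfl⟩
  rw [SetLike.mem_coe, map_monom3_nr φ h₁ h₀ ht]
  refine Ideal.mul_mem_right _ _ (monomial_mem_weightedIdealW c' W' ?_)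
  rwa [weight_nrExp]

variable [IsRegularLocalRing R'] (hgen' : Ideal.span {c' 0, c' 1, c' 2} = maximalIdeal R')
  (hdim' : ringKrullDim R' = 3) (hW' : ∀ i, 0 < W' i)

include h₁ h₀ ht hgen' hdim' hW' in
/-- **Containments descend to the weak transform** (non-rational chart): `J ⊆ F^{(W)}_{ρ′ + μ W′₁}`
implies `(J R′ : (φ u₁)^μ) ⊆ F′^{(W′)}_{ρ′}`. [cite: CossartJannsenSaito2020, (14.8)–(14.10)] -/
theorem colon_le_weightedIdealW_of_le_nr {J : Ideal R} {μ ρ' : ℕ}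
    (hJ : J ≤ weightedIdealW c (nrPullbackWeight W') (ρ' + μ * W' 1)) :
    (J.map φ).colon {φ (c 1) ^ μ} ≤ weightedIdealW c' W' ρ' := by
  intro g hg
  rw [Submodule.mem_colon_singleton, smul_eq_mul, mul_comm] at hg
  have h1 : φ (c 1) ^ μ * g ∈ weightedIdealW c' W' (ρ' + μ * W' 1) :=
    map_weightedIdealW_le_nr φ h₁ h₀ ht W' _ (Ideal.map_mono hJ hg)
  have hmon : φ (c 1) ^ μ = monom3 c' (Finsupp.single 1 μ) := by simp [monom3, h₁]
  have hwt : Finsupp.weight W' (Finsupp.single 1 μ) = μ * W' 1 := by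
    rw [Finsupp.weight_apply, Finsupp.sum_single_index (by simp), smul_eq_mul]
  refine mem_weightedIdealW_of_monom3_mul_mem c' hgen' hdim' hW' (Finsupp.single 1 μ) ?_
  rwa [hwt, ← hmon]

end NonRational

/-! ## The lower bound `α′ ≥ δ − 1` -/

section LowerBound

variable {R R' : Type u} [CommRing R] [CommRing R'] (φ : R →+* R') {c : Fin 3 → R}
  {c' : Fin 3 → R'} (h₁ : c' 1 = φ (c 1)) (h₀ : φ (c 0) = φ (c 1) * c' 0) {t : R'}
  (ht : φ (c 2) = φ (c 1) * t)
  [IsRegularLocalRing R] [IsRegularLocalRing R']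
  (hgen : Ideal.span {c 0, c 1, c 2} = maximalIdeal R) (hdim : ringKrullDim R = 3)
  (hgen' : Ideal.span {c' 0, c' 1, c' 2} = maximalIdeal R') (hdim' : ringKrullDim R' = 3)
  {J : Ideal R} {μ : ℕ}

local notation "J'" => Submodule.colon (Ideal.map φ J) ({φ (c 1) ^ μ} : Set R')

/-- The non-rational pull-back of the level weight `(w₀′, L p₁′, L p₂′)` is the level weight
`(w₀′ + L p₁′, L p₁′, L p₁′)`. [folklore] -/
theorem levelWeight_eq_nrPullbackWeight (μ w₀' p₁' p₂' : ℕ) :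
    levelWeight μ (w₀' + μ.factorial * p₁') p₁' p₁' = nrPullbackWeight (levelWeight μ w₀' p₁' p₂') := by
  funext i; fin_cases i <;> rfl

include h₁ h₀ ht hgen hdim hgen' hdim' in
/-- **Transport of half-planes** (non-rational chart): if all points of `pts c J μ` satisfy
`p₁′ (x₁ + x₂ − L) ≥ w₀′` then all points of `pts c′ J′ μ` satisfy `p₁′ x₁ + p₂′ x₂ ≥ w₀′`, for any
`p₂′ > 0`. [cite: CossartJannsenSaito2020, (14.10)] -/
theorem forall_pts_colon_nr_of_forall_pts {w₀' p₁' p₂' : ℕ} (hw₀' : 0 < w₀') (hp₁' : 0 < p₁')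
    (hp₂' : 0 < p₂')
    (hS : ∀ e ∈ pts c J μ, w₀' + μ.factorial * p₁' ≤ p₁' * spt₁ μ e + p₁' * spt₂ μ e) :
    ∀ e' ∈ pts c' J' μ, w₀' ≤ p₁' * spt₁ μ e' + p₂' * spt₂ μ e' := by
  have hJ : J ≤ weightedIdealW c (levelWeight μ (w₀' + μ.factorial * p₁') p₁' p₁')
      ((w₀' + μ.factorial * p₁') * μ) :=
    (le_weightedIdealW_levelWeight_iff c hgen hdim J (by omega) hp₁' hp₁').mpr hS
  rw [levelWeight_eq_nrPullbackWeight μ w₀' p₁' p₂'] at hJ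
  have hlev : (w₀' + μ.factorial * p₁') * μ = w₀' * μ + μ * (levelWeight μ w₀' p₁' p₂' 1) := by
    rw [levelWeight_one]; ring
  rw [hlev] at hJ
  have hW' := levelWeight_pos (μ := μ) hw₀' hp₁' hp₂'
  have hJ' := colon_le_weightedIdealW_of_le_nr φ h₁ h₀ ht _ hgen' hdim' hW' hJ
  exact (le_weightedIdealW_levelWeight_iff c' hgen' hdim' _ hw₀' hp₁' hp₂').mp hJ'

include h₁ h₀ ht hgen hdim hgen' hdim' in
/-- **`α′ ≥ δ − 1` at a non-rational point** (CoP1 (21), CJS (14.10)): every point of the weak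
transform has `spt₁′ + L ≥ δs` (`L < δs`). [cite: CossartPiltant2008, (21)] [cite: CossartJannsenSaito2020, (14.10)] -/
theorem deltaS_le_spt₁_nr_add (hδ : μ.factorial < deltaS c J μ) {e' : Fin 3 →₀ ℕ}
    (he' : e' ∈ pts c' J' μ) : deltaS c J μ ≤ spt₁ μ e' + μ.factorial := by
  by_contra hlt
  push Not at hlt
  set N := spt₂ μ e' + 1 with hN
  have h := forall_pts_colon_nr_of_forall_pts φ h₁ h₀ ht hgen hdim hgen' hdim'
    (w₀' := N * (deltaS c J μ - μ.factorial)) (p₁' := N) (p₂' := 1)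
    (Nat.mul_pos (by omega) (by omega)) (by omega) Nat.one_pos (fun e he => by
      have hkey : N * (deltaS c J μ - μ.factorial) + μ.factorial * N = N * deltaS c J μ := by
        rw [Nat.mul_sub, mul_comm (μ.factorial) N]
        exact Nat.sub_add_cancel (Nat.mul_le_mul_left _ hδ.le)
      have h1 := Nat.mul_le_mul_left N (deltaS_le he)
      rw [Nat.mul_add] at h1
      omega) e' he'
  have h1 : spt₁ μ e' + 1 ≤ deltaS c J μ - μ.factorial := by omega
  have h2 := Nat.mul_le_mul_left N h1
  rw [Nat.mul_add, mul_one] at h2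
  omega

end LowerBound

/-! ## `φ′`-adic factorisation of polynomials in `t` -/

section Factor

variable {R R' : Type u} [CommRing R] [CommRing R'] [IsLocalRing R]
  (φ : R →+* R') {c : Fin 3 → R} {c' : Fin 3 → R'}
  (hgen : Ideal.span {c 0, c 1, c 2} = maximalIdeal R)
  (h₀ : φ (c 0) = φ (c 1) * c' 0) {t : R'} (ht : φ (c 2) = φ (c 1) * t)

include h₀ ht hgen in
/-- `φ(𝔪) R′ ⊆ (φ u₁)`: the exceptional divisor is principal in the non-rational chart. [cite: CossartJannsenSaito2020, Lemma 14.1] -/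
theorem map_maximalIdeal_le_span_nr : (maximalIdeal R).map φ ≤ Ideal.span {φ (c 1)} := by
  rw [← span_range_eq_of_span_triple c hgen, Ideal.map_span, Ideal.span_le]
  rintro _ ⟨_, ⟨i, rfl⟩, rfl⟩
  fin_cases i
  · change φ (c 0) ∈ _; rw [h₀]; exact Ideal.mul_mem_right _ _ (Ideal.subset_span rfl)
  · exact Ideal.subset_span rfl
  · change φ (c 2) ∈ _; rw [ht]; exact Ideal.mul_mem_right _ _ (Ideal.subset_span rfl)

/-- A polynomial with coefficients in `𝔪` evaluates into `φ(𝔪) R′`. [folklore] -/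
theorem eval₂_mem_map_of_forall_coeff_mem {G : Polynomial R} (hG : ∀ n, G.coeff n ∈ maximalIdeal R)
    (s : R') : Polynomial.eval₂ φ s G ∈ (maximalIdeal R).map φ := by
  rw [Polynomial.eval₂_eq_sum_range]
  refine Ideal.sum_mem _ fun n _ => ?_
  exact Ideal.mul_mem_right _ _ (Ideal.mem_map_of_mem _ (hG n))

/-- Reduction detects coefficients in `𝔪`: `Ḡ = 0 ⟺ ∀ n, G_n ∈ 𝔪`. [folklore] -/
theorem polynomial_map_residue_eq_zero_iff (G : Polynomial R) :
    Polynomial.map (residue R) G = 0 ↔ ∀ n, G.coeff n ∈ maximalIdeal R := by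
  rw [Polynomial.ext_iff]
  refine forall_congr' fun n => ?_
  rw [Polynomial.coeff_map, Polynomial.coeff_zero, residue_eq_zero_iff]

variable [IsLocalRing R'] {P : Polynomial R} (hP : c' 2 = Polynomial.eval₂ φ t P)
  (hres : ∀ G : Polynomial R, Polynomial.eval₂ φ t G ∈ maximalIdeal R' ↔
    Polynomial.map (residue R) P ∣ Polynomial.map (residue R) G)

include h₀ ht hgen hP hres in
/-- **`φ′`-adic factorisation** (CJS (14.4), (14.9)): if `G ∈ R[T]` has nonzero reduction
`Ḡ ∈ k[T]`, then `G(t) = φ′^s · v + φ(u₁) · r` with `v ∈ R′^×`, where `s` is the `P̄`-adic order of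
`Ḡ`; in particular `s · deg P̄ ≤ deg Ḡ`. [cite: CossartJannsenSaito2020, (14.4), (14.9)] [cite: CossartPiltant2008, (20)–(22)] -/
theorem exists_pow_mul_unit_add (hPu : ¬ IsUnit (Polynomial.map (residue R) P)) {G : Polynomial R}
    (hG : Polynomial.map (residue R) G ≠ 0) :
    ∃ (s : ℕ) (v r : R'), IsUnit v ∧
      Polynomial.eval₂ φ t G = c' 2 ^ s * v + φ (c 1) * r ∧
      s * (Polynomial.map (residue R) P).natDegree ≤ (Polynomial.map (residue R) G).natDegree := by
  classical
  set Pb := Polynomial.map (residue R) P with hPb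
  set Gb := Polynomial.map (residue R) G with hGb
  obtain ⟨s, Hb, hndvd, hfac⟩ := WfDvdMonoid.max_power_factor' hG hPu
  -- lift `Hb`
  obtain ⟨H, hH⟩ := Polynomial.map_surjective (residue R) residue_surjective Hb
  -- `G - P^s H` has coefficients in `𝔪`
  have hdiff : ∀ n, (G - P ^ s * H).coeff n ∈ maximalIdeal R := by
    rw [← polynomial_map_residue_eq_zero_iff]
    rw [Polynomial.map_sub, Polynomial.map_mul, Polynomial.map_pow, hH, ← hPb, ← hfac, sub_self]
  have hmem : Polynomial.eval₂ φ t (G - P ^ s * H) ∈ Ideal.span {φ (c 1)} :=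
    map_maximalIdeal_le_span_nr φ hgen h₀ ht (eval₂_mem_map_of_forall_coeff_mem φ hdiff t)
  obtain ⟨r, hr⟩ := Ideal.mem_span_singleton'.mp hmem
  -- `H(t)` is a unit: `P̄ ∤ H̄`
  have hv : IsUnit (Polynomial.eval₂ φ t H) := by
    by_contra hnu
    have hm : Polynomial.eval₂ φ t H ∈ maximalIdeal R' := (mem_maximalIdeal _).mpr hnu
    rw [hres H, hH] at hm
    exact hndvd hm
  refine ⟨s, Polynomial.eval₂ φ t H, r, hv, ?_, ?_⟩
  · have : Polynomial.eval₂ φ t G = Polynomial.eval₂ φ t (P ^ s * H) +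
        Polynomial.eval₂ φ t (G - P ^ s * H) := by
      rw [Polynomial.eval₂_sub]; ring
    rw [this, Polynomial.eval₂_mul, Polynomial.eval₂_pow, ← hP, ← hr, mul_comm r]
  · -- degrees in the domain `k[T]`
    have hHb0 : Hb ≠ 0 := fun h => by rw [h, mul_zero] at hfac; exact hG hfac
    have hpow0 : Pb ^ s ≠ 0 := fun h => by rw [h, zero_mul] at hfac; exact hG hfac
    rw [hfac, Polynomial.natDegree_mul hpow0 hHb0, Polynomial.natDegree_pow]
    exact Nat.le_add_right _ _

end Factor

end Literature.AlgebraicGeometry.Resolution
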